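import Mathlib.Analysis.SpecialFunctions.Pow.Real
import Mathlib.Analysis.SpecialFunctions.Log.Basic
import Mathlib.Analysis.SpecialFunctions.Pow.Asymptotics
import Mathlib.Analysis.Real.Pi.Bounds
import Mathlib.Analysis.Complex.ExponentialBounds
import HarnessLib

/-!
# Conrey–Iwaniec (2002), Proposition 6.4: the final bookkeeping at `Y = qT`, `T ≥ q^65`

B. Conrey, H. Iwaniec, Acta Arith. 103 (2002), §6, Proposition 6.4 (6.52) [held text
`paper:arxiv-math_0111012`, p0016:L53–67 (6.41), p0017:L1–16]: "Introducing this [(6.51)] into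
(6.35) we end up with … `∫_T^{2T}|Σ a(n)λ(n)n^{-1/2-it}|²dt ≪ Tℒ(T) log q` (6.52)". The three
quantities produced by Theorem 6.1/Corollary 6.2 at `Y = qT` — the diagonal
`L(0)T·c₃(ℒ(T)log q + √q T^{-9/20})` ((6.51) with the large-range remainder of Corollary 6.3), the
off-diagonal `2T·c₄L(1,χ)²(log q)²` ((6.34)–(6.35)) and the error
`c₁(1 + c₂q⁶)^{1/2}(1 + 2L(1,χ)²)T⁻¹(qT)^{15/8}(log qT)⁴` ((6.39), `B = q⁶`) — are together
`≤ C·Tℒ(T)log q` once `T ≥ q^65`, GIVEN `L(1,χ) ≥ π/√q` ((1.5), `h ≥ 1`; this is where the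
exponent `65` comes from: `q³·q·q^{15/8} ≪ T^{1/8}`) and `ℒ(T) ≥ L(1,χ)² log T` ((6.50)).
Elementary real inequalities; this is the registered stub S6 `stub_absorb` of SKELETON P64
(cell landau-siegel/ls-inputs, line `thm61-cm-convolution`), signature verbatim.

## References
* [ConreyIwaniec2002] B. Conrey, H. Iwaniec, Acta Arith. 103 (2002) 259–312: §6 (6.41), (6.50)–(6.52); §1 (1.5).
-/

noncomputable section

namespace Literature.NumberTheory.LFunctions

namespace ConreyIwaniec2002

/-- `log x ≤ 100·x^{1/100}` for `x ≥ 0` (Mathlib `Real.log_le_rpow_div`). [folklore] -/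
private theorem log_le_hundred_mul_rpow {x : ℝ} (hx : 0 ≤ x) :
    Real.log x ≤ 100 * x ^ (1 / 100 : ℝ) := by
  have h := Real.log_le_rpow_div hx (by norm_num : (0 : ℝ) < 1 / 100)
  calc Real.log x ≤ x ^ (1 / 100 : ℝ) / (1 / 100) := h
    _ = 100 * x ^ (1 / 100 : ℝ) := by ring

/-- **Proposition 6.4, the final bookkeeping** (registered stub S6 `stub_absorb` of SKELETON P64):
with `π/√q ≤ ℓ` and `ℓ² log T ≤ ℒ`, for `q ≥ 5` and `T ≥ q^65` the diagonal, off-diagonal and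
error outputs of Theorem 6.1 at `Y = qT` are `≤ C·T·ℒ·log q`.
[cite: ConreyIwaniec2002, Proposition 6.4 (6.52); (6.41); §1 (1.5)] -/
theorem prop64_absorb :
    ∀ (L0 c₁ c₂ c₃ c₄ : ℝ), 0 ≤ L0 → 0 ≤ c₁ → 0 ≤ c₂ → 0 ≤ c₃ → 0 ≤ c₄ →
      ∃ C : ℝ, 0 < C ∧
        ∀ (q T ℓ calLT : ℝ), 5 ≤ q → q ^ (65 : ℕ) ≤ T → Real.pi / Real.sqrt q ≤ ℓ →
          ℓ ^ 2 * Real.log T ≤ calLT →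
            L0 * T * (c₃ * (calLT * Real.log q + Real.sqrt q * T ^ (-(9 / 20 : ℝ)))) +
                2 * T * (c₄ * ℓ ^ 2 * Real.log q ^ 2) +
                c₁ * (1 + c₂ * q ^ (6 : ℕ)) ^ (1 / 2 : ℝ) * (1 + 2 * ℓ ^ 2) * T⁻¹ *
                  (q * T) ^ (15 / 8 : ℝ) * Real.log (q * T) ^ 4 ≤
              C * (T * calLT * Real.log q) := by
  intro L0 c₁ c₂ c₃ c₄ hL0 hc₁ hc₂ hc₃ hc₄
  refine ⟨2 * L0 * c₃ + 2 * c₄ + 16000000 * c₁ * (1 + c₂) + 1, by positivity, ?_⟩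
  intro q T ℓ calLT hq hT hℓ hcalL
  -- basic ranges
  have hq0 : 0 < q := by linarith
  have hq1 : (1 : ℝ) ≤ q := by linarith
  have hqT : q ≤ T := le_trans (le_self_pow₀ hq1 (by norm_num)) hT
  have hT1 : (1 : ℝ) < T := by linarith
  have hT0 : 0 < T := by linarith
  have hlogq1 : 1 ≤ Real.log q := by
    rw [← Real.log_exp 1]
    refine Real.log_le_log (Real.exp_pos 1) ?_
    have := Real.exp_one_lt_three
    linarith
  have hlogq0 : 0 < Real.log q := by linarith
  have hlogT : 65 * Real.log q ≤ Real.log T := by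
    have h := Real.log_le_log (by positivity) hT
    rwa [Real.log_pow, Nat.cast_ofNat] at h
  have hlogT0 : 0 < Real.log T := by linarith
  have hlogqT : Real.log q ≤ Real.log T / 65 := by linarith
  -- `ℓ² q ≥ π² ≥ 9`, `ℓ > 0`
  have hsq : 0 < Real.sqrt q := Real.sqrt_pos.mpr hq0
  have hℓ0 : 0 < ℓ := lt_of_lt_of_le (div_pos Real.pi_pos hsq) hℓ
  have hℓq : 9 ≤ ℓ ^ 2 * q := by
    have h1 : Real.pi / Real.sqrt q ≤ ℓ := hℓ
    have h2 : 0 ≤ Real.pi / Real.sqrt q := by positivity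
    have h3 : (Real.pi / Real.sqrt q) ^ 2 ≤ ℓ ^ 2 := pow_le_pow_left₀ h2 h1 2
    have h4 : (Real.pi / Real.sqrt q) ^ 2 = Real.pi ^ 2 / q := by
      rw [div_pow, Real.sq_sqrt hq0.le]
    rw [h4, div_le_iff₀ hq0] at h3
    have hpi : 3 ≤ Real.pi := by linarith [Real.pi_gt_three]
    nlinarith [mul_self_le_mul_self (by norm_num : (0:ℝ) ≤ 3) hpi]
  have hcal0 : 0 < calLT := lt_of_lt_of_le (by positivity) hcalL
  -- the budget `M = T ℒ log q` and its lower bound `T ℓ² log T log q ≥ 9 T log q / q · log T`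
  set M : ℝ := T * calLT * Real.log q with hM
  have hM0 : 0 < M := by positivity
  have hM1 : T * (ℓ ^ 2 * Real.log T) * Real.log q ≤ M :=
    mul_le_mul_of_nonneg_right (mul_le_mul_of_nonneg_left hcalL hT0.le) hlogq0.le
  -- Term 1a
  have t1a : L0 * T * (c₃ * (calLT * Real.log q)) = L0 * c₃ * M := by rw [hM]; ring
  -- Term 1b: `√q T^{-9/20} ≤ calLT log q`
  have t1b : Real.sqrt q * T ^ (-(9 / 20 : ℝ)) ≤ calLT * Real.log q := by
    -- `T^{9/20} ≥ q^{9/20·65} ≥ q^{3/2} ≥ q · √q`, so `√q T^{-9/20} ≤ 1/q ≤ ℓ² log T log q`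
    have hT920 : q * Real.sqrt q ≤ T ^ (9 / 20 : ℝ) := by
      have h1 : (q : ℝ) ^ (65 : ℝ) ≤ T := by rwa [← Real.rpow_natCast] at hT
      have h2 : (q ^ (65 : ℝ)) ^ (9 / 20 : ℝ) ≤ T ^ (9 / 20 : ℝ) :=
        Real.rpow_le_rpow (by positivity) h1 (by norm_num)
      rw [← Real.rpow_mul hq0.le] at h2
      have h3 : q * Real.sqrt q = q ^ (3 / 2 : ℝ) := by
        rw [Real.sqrt_eq_rpow, ← Real.rpow_one_add' hq0.le (by norm_num)]
        norm_num
      rw [h3]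
      exact le_trans (Real.rpow_le_rpow_of_exponent_le hq1 (by norm_num)) h2
    have hpos : 0 < T ^ (9 / 20 : ℝ) := Real.rpow_pos_of_pos hT0 _
    have h4 : Real.sqrt q * T ^ (-(9 / 20 : ℝ)) ≤ q⁻¹ := by
      rw [Real.rpow_neg hT0.le, ← div_eq_mul_inv, div_le_iff₀ hpos, ← div_eq_inv_mul,
        le_div_iff₀ hq0]
      calc Real.sqrt q * q = q * Real.sqrt q := mul_comm _ _
        _ ≤ T ^ (9 / 20 : ℝ) := hT920
    have h5 : q⁻¹ ≤ ℓ ^ 2 * Real.log T * Real.log q := by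
      rw [inv_le_iff_one_le_mul₀ hq0]
      have : 9 ≤ ℓ ^ 2 * q := hℓq
      have h6 : 1 ≤ Real.log T := le_trans hlogq1 (by linarith)
      calc (1 : ℝ) ≤ ℓ ^ 2 * q := by linarith
        _ = ℓ ^ 2 * q * 1 * 1 := by ring
        _ ≤ ℓ ^ 2 * q * Real.log T * Real.log q := by gcongr
        _ = ℓ ^ 2 * Real.log T * Real.log q * q := by ring
    calc Real.sqrt q * T ^ (-(9 / 20 : ℝ)) ≤ q⁻¹ := h4
      _ ≤ ℓ ^ 2 * Real.log T * Real.log q := h5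
      _ ≤ calLT * Real.log q := mul_le_mul_of_nonneg_right hcalL hlogq0.le
  have t1 : L0 * T * (c₃ * (calLT * Real.log q + Real.sqrt q * T ^ (-(9 / 20 : ℝ)))) ≤
      2 * L0 * c₃ * M := by
    have : L0 * T * (c₃ * (calLT * Real.log q + Real.sqrt q * T ^ (-(9 / 20 : ℝ)))) ≤
        L0 * T * (c₃ * (calLT * Real.log q + calLT * Real.log q)) := by gcongr
    refine le_trans this (le_of_eq ?_)
    rw [hM]; ring
  -- Term 2: `ℓ² log² q ≤ ℓ² log T log q / 65 ≤ calLT log q`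
  have t2 : 2 * T * (c₄ * ℓ ^ 2 * Real.log q ^ 2) ≤ 2 * c₄ * M := by
    have h1 : ℓ ^ 2 * Real.log q ^ 2 ≤ calLT * Real.log q := by
      have : Real.log q ^ 2 = Real.log q * Real.log q := sq _
      rw [this]
      calc ℓ ^ 2 * (Real.log q * Real.log q) = (ℓ ^ 2 * Real.log q) * Real.log q := by ring
        _ ≤ (ℓ ^ 2 * Real.log T) * Real.log q := by gcongr
        _ ≤ calLT * Real.log q := mul_le_mul_of_nonneg_right hcalL hlogq0.le
    calc 2 * T * (c₄ * ℓ ^ 2 * Real.log q ^ 2) = 2 * c₄ * (T * (ℓ ^ 2 * Real.log q ^ 2)) := by ring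
      _ ≤ 2 * c₄ * (T * (calLT * Real.log q)) := by gcongr
      _ = 2 * c₄ * M := by rw [hM]; ring
  -- Term 3
  have t3 : c₁ * (1 + c₂ * q ^ (6 : ℕ)) ^ (1 / 2 : ℝ) * (1 + 2 * ℓ ^ 2) * T⁻¹ *
      (q * T) ^ (15 / 8 : ℝ) * Real.log (q * T) ^ 4 ≤ 16000000 * c₁ * (1 + c₂) * M := by
    -- (a) the square root
    have ha : (1 + c₂ * q ^ (6 : ℕ)) ^ (1 / 2 : ℝ) ≤ (1 + c₂) * q ^ (3 : ℕ) := by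
      rw [← Real.sqrt_eq_rpow]
      have h1 : 1 + c₂ * q ^ (6 : ℕ) ≤ ((1 + c₂) * q ^ (3 : ℕ)) ^ 2 := by
        have hq6 : (1 : ℝ) ≤ q ^ (6 : ℕ) := one_le_pow₀ hq1
        have : ((1 + c₂) * q ^ (3 : ℕ)) ^ 2 = (1 + c₂) ^ 2 * q ^ (6 : ℕ) := by ring
        rw [this]
        nlinarith
      calc Real.sqrt (1 + c₂ * q ^ (6 : ℕ)) ≤ Real.sqrt (((1 + c₂) * q ^ (3 : ℕ)) ^ 2) :=
            Real.sqrt_le_sqrt h1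
        _ = (1 + c₂) * q ^ (3 : ℕ) := Real.sqrt_sq (by positivity)
    -- (b) `1 + 2ℓ² ≤ q ℓ²`
    have hb : 1 + 2 * ℓ ^ 2 ≤ q * ℓ ^ 2 := by nlinarith
    -- (c) `T⁻¹ (qT)^{15/8} = q^{15/8} T^{7/8}`
    have hc : T⁻¹ * (q * T) ^ (15 / 8 : ℝ) = q ^ (15 / 8 : ℝ) * T ^ (7 / 8 : ℝ) := by
      rw [Real.mul_rpow hq0.le hT0.le]
      have : T ^ (7 / 8 : ℝ) = T ^ (15 / 8 : ℝ) * T⁻¹ := by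
        rw [← Real.rpow_neg_one, ← Real.rpow_add hT0]; norm_num
      rw [this]; ring
    -- (d) the logarithms
    have hd1 : Real.log (q * T) ≤ 2 * Real.log T := by
      rw [Real.log_mul hq0.ne' hT0.ne']; linarith
    have hd2 : Real.log (q * T) ^ 4 ≤ 16 * Real.log T ^ 4 := by
      have h0 : 0 ≤ Real.log (q * T) := Real.log_nonneg (by nlinarith)
      calc Real.log (q * T) ^ 4 ≤ (2 * Real.log T) ^ 4 := pow_le_pow_left₀ h0 hd1 4
        _ = 16 * Real.log T ^ 4 := by ring
    have hd3 : Real.log T ^ 3 ≤ 1000000 * T ^ (3 / 100 : ℝ) := by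
      have h1 := log_le_hundred_mul_rpow hT0.le
      calc Real.log T ^ 3 ≤ (100 * T ^ (1 / 100 : ℝ)) ^ 3 := pow_le_pow_left₀ hlogT0.le h1 3
        _ = 1000000 * (T ^ (1 / 100 : ℝ)) ^ (3 : ℕ) := by ring
        _ = 1000000 * T ^ (3 / 100 : ℝ) := by
          rw [← Real.rpow_natCast, ← Real.rpow_mul hT0.le]; norm_num
    -- (e) the powers: `q^{47/8} T^{7/8 + 3/100} ≤ T`
    have he : q ^ (3 : ℕ) * q * q ^ (15 / 8 : ℝ) * (T ^ (7 / 8 : ℝ) * T ^ (3 / 100 : ℝ)) ≤ T := by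
      have h1 : q ^ (3 : ℕ) * q * q ^ (15 / 8 : ℝ) = q ^ (47 / 8 : ℝ) := by
        rw [← Real.rpow_natCast q 3, ← Real.rpow_add_one' hq0.le (by norm_num),
          ← Real.rpow_add hq0]
        norm_num
      have h2 : T ^ (7 / 8 : ℝ) * T ^ (3 / 100 : ℝ) = T ^ (181 / 200 : ℝ) := by
        rw [← Real.rpow_add hT0]; norm_num
      rw [h1, h2]
      have h3 : q ^ (47 / 8 : ℝ) ≤ T ^ (19 / 200 : ℝ) := by
        have h4 : (q : ℝ) ^ (65 : ℝ) ≤ T := by rwa [← Real.rpow_natCast] at hT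
        have h5 : (q ^ (65 : ℝ)) ^ (19 / 200 : ℝ) ≤ T ^ (19 / 200 : ℝ) :=
          Real.rpow_le_rpow (by positivity) h4 (by norm_num)
        rw [← Real.rpow_mul hq0.le] at h5
        exact le_trans (Real.rpow_le_rpow_of_exponent_le hq1 (by norm_num)) h5
      calc q ^ (47 / 8 : ℝ) * T ^ (181 / 200 : ℝ) ≤ T ^ (19 / 200 : ℝ) * T ^ (181 / 200 : ℝ) :=
          mul_le_mul_of_nonneg_right h3 (by positivity)
        _ = T := by rw [← Real.rpow_add hT0]; norm_num
    -- assemble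
    have hℓ2 : 0 ≤ ℓ ^ 2 := sq_nonneg _
    calc c₁ * (1 + c₂ * q ^ (6 : ℕ)) ^ (1 / 2 : ℝ) * (1 + 2 * ℓ ^ 2) * T⁻¹ *
          (q * T) ^ (15 / 8 : ℝ) * Real.log (q * T) ^ 4
        = c₁ * (1 + c₂ * q ^ (6 : ℕ)) ^ (1 / 2 : ℝ) * (1 + 2 * ℓ ^ 2) *
            (T⁻¹ * (q * T) ^ (15 / 8 : ℝ)) * Real.log (q * T) ^ 4 := by ring
      _ ≤ c₁ * ((1 + c₂) * q ^ (3 : ℕ)) * (q * ℓ ^ 2) *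
            (q ^ (15 / 8 : ℝ) * T ^ (7 / 8 : ℝ)) * (16 * Real.log T ^ 4) := by
          rw [hc]; gcongr
      _ = 16 * c₁ * (1 + c₂) * ℓ ^ 2 * Real.log T *
            (q ^ (3 : ℕ) * q * q ^ (15 / 8 : ℝ) * (T ^ (7 / 8 : ℝ) * Real.log T ^ 3)) := by ring
      _ ≤ 16 * c₁ * (1 + c₂) * ℓ ^ 2 * Real.log T *
            (q ^ (3 : ℕ) * q * q ^ (15 / 8 : ℝ) * (T ^ (7 / 8 : ℝ) * (1000000 * T ^ (3 / 100 : ℝ)))) := by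
          gcongr
      _ = 16000000 * c₁ * (1 + c₂) * (ℓ ^ 2 * Real.log T) *
            (q ^ (3 : ℕ) * q * q ^ (15 / 8 : ℝ) * (T ^ (7 / 8 : ℝ) * T ^ (3 / 100 : ℝ))) := by ring
      _ ≤ 16000000 * c₁ * (1 + c₂) * (ℓ ^ 2 * Real.log T) * T := by gcongr
      _ = 16000000 * c₁ * (1 + c₂) * (T * (ℓ ^ 2 * Real.log T) * 1) := by ring
      _ ≤ 16000000 * c₁ * (1 + c₂) * (T * (ℓ ^ 2 * Real.log T) * Real.log q) := by gcongr
      _ ≤ 16000000 * c₁ * (1 + c₂) * M := by gcongr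
  -- total
  have htot := add_le_add (add_le_add t1 t2) t3
  refine le_trans htot ?_
  rw [hM]
  nlinarith
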